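import Literature.NumberTheory.LFunctions.WeilWindowSuzukiContinuityProofs
import HarnessLib

/-!
# Stub `stub_branchesContinuous` (line `cofinite-weil-index-staircase`), auxiliary file 1:
finite-span algebra for Weil's quadratic functional

Helper file for the crux `RuelleBand.CofiniteCriticalLine` (item stmt-RiemannHypothesis-2064),
stub `stub_branchesContinuous` (continuity of every Courant–Fischer level of the window form in
the window).  Normalisation of `Literature/NumberTheory/LFunctions/WeilExplicit.lean`:
`Q(g) = weilQuadratic g = W(g ⋆ g̃)`, `W = weilFunctional`, test functions `IsWeilTest`.

Contents (all proved, no definitions):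
* finite linear combinations `t ↦ ∑ i ∈ s, c i * g i t` of test functions are test functions,
  with controlled support;
* `W` is additive on test kernels (a copy of the API of
  `Literature/NumberTheory/LFunctions/WeilWindowSimpleEven.lean`, which cannot be imported next
  to `WeilWindowSuzukiContinuityProofs.lean` because of a name clash on `WeilWindowSimpleEven`);
* the SESQUILINEAR EXPANSION
  `Q(∑ cᵢ gᵢ) = ∑ⱼ conj cⱼ ∑ᵢ cᵢ W(gᵢ ⋆ g̃ⱼ)` and `∫ ‖∑ cᵢ gᵢ‖² = ∑ⱼ conj cⱼ ∑ᵢ cᵢ (gᵢ ⋆ g̃ⱼ)(0)`,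
  whence `c ↦ Re Q(∑ cᵢ gᵢ)` and `c ↦ ∫ ‖∑ cᵢ gᵢ‖²` are continuous on `Fin (k+1) → ℂ`;
* Bombieri's dilation `weilDilate η` is linear on combinations and preserves linear independence.
-/

set_option linter.dupNamespace false

noncomputable section

open Complex MeasureTheory Filter Set
open scoped BigOperators Topology ComplexConjugate

namespace Summit.RiemannHypothesis.RiemannHypothesis.Theorems.RuelleBandCofiniteCriticalLine

open Literature.NumberTheory.LFunctions

variable {ι : Type*}

/-! ## Finite combinations of test functions -/

/-- A finite sum of test functions is a test function. [folklore] -/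
theorem stub_branchesContinuous_isWeilTest_sum (s : Finset ι) {F : ι → ℝ → ℂ}
    (hF : ∀ i ∈ s, IsWeilTest (F i)) : IsWeilTest (fun t => ∑ i ∈ s, F i t) := by
  classical
  induction s using Finset.induction_on with
  | empty =>
    simp only [Finset.sum_empty]
    exact ⟨contDiff_const, HasCompactSupport.zero⟩
  | insert a s ha ih =>
    have h1 : IsWeilTest (F a) := hF a (Finset.mem_insert_self a s)
    have h2 : IsWeilTest (fun t => ∑ i ∈ s, F i t) :=
      ih fun i hi => hF i (Finset.mem_insert_of_mem hi)
    have h := h1.add h2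
    convert h using 1
    funext t
    simp [Finset.sum_insert ha]

/-- The support of a finite sum lies in any closed set containing the supports of the summands.
[folklore] -/
theorem stub_branchesContinuous_tsupport_sum_subset (s : Finset ι) {F : ι → ℝ → ℂ} {A : Set ℝ}
    (hA : IsClosed A) (h : ∀ i ∈ s, tsupport (F i) ⊆ A) :
    tsupport (fun t => ∑ i ∈ s, F i t) ⊆ A := by
  refine closure_minimal (fun t ht => ?_) hA
  by_contra hta
  refine ht (Finset.sum_eq_zero fun i hi => ?_)
  exact image_eq_zero_of_notMem_tsupport fun h' => hta (h i hi h')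

/-- A linear combination of test functions is a test function. [folklore] -/
theorem stub_branchesContinuous_isWeilTest_comb (s : Finset ι) (c : ι → ℂ) {g : ι → ℝ → ℂ}
    (hg : ∀ i ∈ s, IsWeilTest (g i)) : IsWeilTest (fun t => ∑ i ∈ s, c i * g i t) :=
  stub_branchesContinuous_isWeilTest_sum s fun i hi => (hg i hi).const_mul (c i)

/-- A linear combination of functions supported in the window `[-a, a]` is supported there.
[folklore] -/
theorem stub_branchesContinuous_tsupport_comb_subset (s : Finset ι) (c : ι → ℂ) {g : ι → ℝ → ℂ}
    {a : ℝ} (hg : ∀ i ∈ s, tsupport (g i) ⊆ Icc (-a) a) :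
    tsupport (fun t => ∑ i ∈ s, c i * g i t) ⊆ Icc (-a) a :=
  stub_branchesContinuous_tsupport_sum_subset s isClosed_Icc fun i hi =>
    (tsupport_mul_subset_right (f := fun _ : ℝ => c i) (g := g i)).trans (hg i hi)

/-- The involution on a combination: `(∑ cᵢ gᵢ)̃ = ∑ conj cᵢ · g̃ᵢ`. [folklore] -/
theorem stub_branchesContinuous_weilReflect_comb (s : Finset ι) (c : ι → ℂ) (g : ι → ℝ → ℂ) :
    weilReflect (fun t => ∑ i ∈ s, c i * g i t) =
      fun t => ∑ i ∈ s, conj (c i) * weilReflect (g i) t := by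
  funext t
  simp [weilReflect, map_sum]

/-- Left linearity of the convolution over combinations of test functions:
`(∑ cᵢ gᵢ) ⋆ h = ∑ cᵢ (gᵢ ⋆ h)` for `h` continuous. [folklore] -/
theorem stub_branchesContinuous_weilConv_comb_left (s : Finset ι) (c : ι → ℂ) {g : ι → ℝ → ℂ}
    {h : ℝ → ℂ} (hg : ∀ i ∈ s, IsWeilTest (g i)) (hh : Continuous h) :
    weilConv (fun t => ∑ i ∈ s, c i * g i t) h = fun t => ∑ i ∈ s, c i * weilConv (g i) h t := by
  funext t
  rw [weilConv_apply]
  have hint : ∀ i ∈ s, Integrable (fun u : ℝ => c i * (g i u * h (t - u))) := by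
    intro i hi
    have hc : Continuous fun u : ℝ => g i u * h (t - u) :=
      (hg i hi).1.continuous.mul (hh.comp (continuous_const.sub continuous_id))
    exact (hc.integrable_of_hasCompactSupport (hg i hi).2.mul_right).const_mul (c i)
  have e : ∀ u : ℝ, (∑ i ∈ s, c i * g i u) * h (t - u) = ∑ i ∈ s, c i * (g i u * h (t - u)) := by
    intro u
    rw [Finset.sum_mul]
    exact Finset.sum_congr rfl fun i _ => by ring
  simp_rw [e]
  rw [integral_finsetSum _ hint]
  refine Finset.sum_congr rfl fun i _ => ?_
  rw [integral_const_mul, weilConv_apply]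

/-- Right linearity of the convolution over combinations:
`g ⋆ (∑ cᵢ hᵢ) = ∑ cᵢ (g ⋆ hᵢ)` for `g` a test function and `hᵢ` continuous. [folklore] -/
theorem stub_branchesContinuous_weilConv_comb_right (s : Finset ι) (c : ι → ℂ) {g : ℝ → ℂ}
    {h : ι → ℝ → ℂ} (hg : IsWeilTest g) (hh : ∀ i ∈ s, Continuous (h i)) :
    weilConv g (fun t => ∑ i ∈ s, c i * h i t) = fun t => ∑ i ∈ s, c i * weilConv g (h i) t := by
  funext t
  rw [weilConv_apply]
  have hint : ∀ i ∈ s, Integrable (fun u : ℝ => c i * (g u * h i (t - u))) := by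
    intro i hi
    have hc : Continuous fun u : ℝ => g u * h i (t - u) :=
      hg.1.continuous.mul ((hh i hi).comp (continuous_const.sub continuous_id))
    exact (hc.integrable_of_hasCompactSupport hg.2.mul_right).const_mul (c i)
  have e : ∀ u : ℝ, g u * (∑ i ∈ s, c i * h i (t - u)) = ∑ i ∈ s, c i * (g u * h i (t - u)) := by
    intro u
    rw [Finset.mul_sum]
    exact Finset.sum_congr rfl fun i _ => by ring
  simp_rw [e]
  rw [integral_finsetSum _ hint]
  refine Finset.sum_congr rfl fun i _ => ?_
  rw [integral_const_mul, weilConv_apply]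

/-- **The autocorrelation of a combination**: for test functions `gᵢ`,
`(∑ cᵢ gᵢ) ⋆ (∑ cᵢ gᵢ)̃ = ∑ⱼ conj cⱼ ∑ᵢ cᵢ (gᵢ ⋆ g̃ⱼ)` pointwise. [folklore] -/
theorem stub_branchesContinuous_weilConv_weilReflect_comb (s : Finset ι) (c : ι → ℂ)
    {g : ι → ℝ → ℂ} (hg : ∀ i ∈ s, IsWeilTest (g i)) :
    weilConv (fun t => ∑ i ∈ s, c i * g i t) (weilReflect fun t => ∑ i ∈ s, c i * g i t) =
      fun t => ∑ j ∈ s, conj (c j) * ∑ i ∈ s, c i * weilConv (g i) (weilReflect (g j)) t := by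
  rw [stub_branchesContinuous_weilReflect_comb,
    stub_branchesContinuous_weilConv_comb_right s _ (stub_branchesContinuous_isWeilTest_comb s c hg)
      fun j hj => (hg j hj).weilReflect.1.continuous]
  funext t
  refine Finset.sum_congr rfl fun j hj => ?_
  rw [stub_branchesContinuous_weilConv_comb_left s c hg (hg j hj).weilReflect.1.continuous]

/-! ## Additivity of the Weil functional on test kernels

Copies of `integrable_weilArchIntegrand`, `weilArchIntegral_add`, `weilFunctional_add` of
`Literature/NumberTheory/LFunctions/WeilWindowSimpleEven.lean` (not importable here, see the
module docstring). -/

-- adapted from Literature/NumberTheory/LFunctions/WeilWindowSimpleEven.lean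
/-- The archimedean integrand `t ↦ k̂(1/2 + it) · Re ψ(1/4 + it/2)` of `weilArchIntegral k` is
integrable for every test function `k` (`|k̂| ≤ D/(1 + t²)²` on the critical line and
`|ψ(1/4 + it/2)| ≤ C + log(1 + |t|)`). [folklore] -/
theorem stub_branchesContinuous_integrable_weilArchIntegrand {k : ℝ → ℂ} (hk : IsWeilTest k) :
    Integrable fun t : ℝ => weilMellin k (1 / 2 + t * I) *
      ((Complex.digamma (1 / 4 + t / 2 * I)).re : ℂ) := by
  obtain ⟨C, hC⟩ :=
    Literature.Analysis.SpecialFunctions.Complex.exists_norm_digamma_vertical_le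
      (a := 1 / 4) (by norm_num)
  set F : ℝ → ℂ := fun t => ((Complex.digamma (1 / 4 + t / 2 * I)).re : ℂ) with hF
  have hw : ∀ t : ℝ, (1 / 4 : ℂ) + (t : ℂ) / 2 * I = ((1 / 4 : ℝ) : ℂ) + ((t / 2 : ℝ) : ℂ) * I := by
    intro t
    push_cast
    ring
  have hFc : Continuous F := by
    refine continuous_ofReal.comp (Complex.continuous_re.comp ?_)
    refine Literature.Analysis.SpecialFunctions.Complex.continuousOn_digamma.comp_continuous
      (by fun_prop) fun t => ?_
    rw [hw t]
    simp
  have hFb : ∀ t : ℝ, ‖F t‖ ≤ C + Real.log (1 + |t|) := by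
    intro t
    have h1 : ‖F t‖ ≤ ‖Complex.digamma (1 / 4 + t / 2 * I)‖ := by
      simp only [hF, Complex.norm_real, Real.norm_eq_abs]
      exact Complex.abs_re_le_norm _
    have h2 := hC (t / 2)
    rw [← hw t] at h2
    have h3 : Real.log (1 + |t / 2|) ≤ Real.log (1 + |t|) := by
      refine Real.log_le_log (by positivity) ?_
      rw [abs_div, abs_two]
      linarith [abs_nonneg t]
    linarith
  have hI := integrable_mul_weilMellin_vertical_of_norm_le_log hk (1 / 2) hFc hFb
  refine hI.congr (Eventually.of_forall fun t => ?_)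
  simp only [hF]
  rw [mul_comm]
  push_cast
  ring_nf

-- adapted from Literature/NumberTheory/LFunctions/WeilWindowSimpleEven.lean
/-- Additivity of the archimedean integral on test kernels. [folklore] -/
theorem stub_branchesContinuous_weilArchIntegral_add {k₁ k₂ : ℝ → ℂ} (hk₁ : IsWeilTest k₁)
    (hk₂ : IsWeilTest k₂) :
    weilArchIntegral (k₁ + k₂) = weilArchIntegral k₁ + weilArchIntegral k₂ := by
  unfold weilArchIntegral
  rw [← integral_add (stub_branchesContinuous_integrable_weilArchIntegrand hk₁)
    (stub_branchesContinuous_integrable_weilArchIntegrand hk₂)]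
  congr 1 with t
  rw [weilMellin_add hk₁.1.continuous hk₁.2 hk₂.1.continuous hk₂.2]
  ring

-- adapted from Literature/NumberTheory/LFunctions/WeilWindowSimpleEven.lean
/-- **Additivity of the Weil functional on test kernels**: `W(k₁ + k₂) = W(k₁) + W(k₂)`.
[folklore] -/
theorem stub_branchesContinuous_weilFunctional_add {k₁ k₂ : ℝ → ℂ} (hk₁ : IsWeilTest k₁)
    (hk₂ : IsWeilTest k₂) :
    weilFunctional (k₁ + k₂) = weilFunctional k₁ + weilFunctional k₂ := by
  have hM := weilMellin_add hk₁.1.continuous hk₁.2 hk₂.1.continuous hk₂.2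
  have hP : weilPolarTerm (k₁ + k₂) = weilPolarTerm k₁ + weilPolarTerm k₂ := by
    simp only [weilPolarTerm, hM]
    ring
  have hPr : weilPrimeTerm (k₁ + k₂) = weilPrimeTerm k₁ + weilPrimeTerm k₂ := by
    unfold weilPrimeTerm
    rw [← (summable_weilPrimeTerm hk₁.2).tsum_add (summable_weilPrimeTerm hk₂.2)]
    refine tsum_congr fun n => ?_
    simp only [Pi.add_apply]
    ring
  have hA : weilArchTerm (k₁ + k₂) = weilArchTerm k₁ + weilArchTerm k₂ := by
    simp only [weilArchTerm, stub_branchesContinuous_weilArchIntegral_add hk₁ hk₂, Pi.add_apply]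
    ring
  simp only [weilFunctional, hP, hPr, hA]
  ring

/-- `W(0) = 0`. [folklore] -/
theorem stub_branchesContinuous_weilFunctional_zero :
    weilFunctional (fun _ : ℝ => (0 : ℂ)) = 0 := by
  have h := weilFunctional_const_mul 0 (fun _ : ℝ => (0 : ℂ))
  simp only [zero_mul] at h
  exact h

/-- `W` over finite sums of test kernels: `W(∑ Fᵢ) = ∑ W(Fᵢ)`. [folklore] -/
theorem stub_branchesContinuous_weilFunctional_sum (s : Finset ι) {F : ι → ℝ → ℂ}
    (hF : ∀ i ∈ s, IsWeilTest (F i)) :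
    weilFunctional (fun t => ∑ i ∈ s, F i t) = ∑ i ∈ s, weilFunctional (F i) := by
  classical
  induction s using Finset.induction_on with
  | empty =>
    simp only [Finset.sum_empty]
    exact stub_branchesContinuous_weilFunctional_zero
  | insert a s ha ih =>
    have h1 : IsWeilTest (F a) := hF a (Finset.mem_insert_self a s)
    have hF' : ∀ i ∈ s, IsWeilTest (F i) := fun i hi => hF i (Finset.mem_insert_of_mem hi)
    have h2 : IsWeilTest (fun t => ∑ i ∈ s, F i t) := stub_branchesContinuous_isWeilTest_sum s hF'
    have e : (fun t => ∑ i ∈ insert a s, F i t) = F a + fun t => ∑ i ∈ s, F i t := by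
      funext t
      simp [Finset.sum_insert ha]
    rw [e, stub_branchesContinuous_weilFunctional_add h1 h2, ih hF', Finset.sum_insert ha]

/-! ## The sesquilinear expansion and continuity in the coefficients -/

/-- **Sesquilinear expansion of Weil's quadratic functional on a finite span**: for test
functions `gᵢ`, `Q(∑ cᵢ gᵢ) = ∑ⱼ conj cⱼ ∑ᵢ cᵢ W(gᵢ ⋆ g̃ⱼ)` (Bombieri 2000 §3: `T[f * f̄*]` is a
hermitian form). [folklore] -/
theorem stub_branchesContinuous_weilQuadratic_comb (s : Finset ι) (c : ι → ℂ) {g : ι → ℝ → ℂ}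
    (hg : ∀ i ∈ s, IsWeilTest (g i)) :
    weilQuadratic (fun t => ∑ i ∈ s, c i * g i t) =
      ∑ j ∈ s, conj (c j) * ∑ i ∈ s, c i * weilFunctional (weilConv (g i) (weilReflect (g j))) := by
  have hK : ∀ i ∈ s, ∀ j ∈ s, IsWeilTest (weilConv (g i) (weilReflect (g j))) :=
    fun i hi j hj => (hg i hi).weilConv (hg j hj).weilReflect
  unfold weilQuadratic
  rw [stub_branchesContinuous_weilConv_weilReflect_comb s c hg,
    stub_branchesContinuous_weilFunctional_sum s
      (F := fun j t => conj (c j) * ∑ i ∈ s, c i * weilConv (g i) (weilReflect (g j)) t) ?_]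
  · refine Finset.sum_congr rfl fun j hj => ?_
    rw [weilFunctional_const_mul (conj (c j))
        (fun t => ∑ i ∈ s, c i * weilConv (g i) (weilReflect (g j)) t),
      stub_branchesContinuous_weilFunctional_sum s
        (F := fun i t => c i * weilConv (g i) (weilReflect (g j)) t)
        fun i hi => (hK i hi j hj).const_mul (c i)]
    congr 1
    refine Finset.sum_congr rfl fun i _ => ?_
    exact weilFunctional_const_mul (c i) (weilConv (g i) (weilReflect (g j)))
  · intro j hj
    exact (stub_branchesContinuous_isWeilTest_sum s
      fun i hi => (hK i hi j hj).const_mul (c i)).const_mul (conj (c j))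

/-- **The `L²` norm of a combination as a hermitian form**:
`∫ ‖∑ cᵢ gᵢ‖² = ∑ⱼ conj cⱼ ∑ᵢ cᵢ (gᵢ ⋆ g̃ⱼ)(0)` (as complex numbers). [folklore] -/
theorem stub_branchesContinuous_integral_norm_sq_comb (s : Finset ι) (c : ι → ℂ)
    {g : ι → ℝ → ℂ} (hg : ∀ i ∈ s, IsWeilTest (g i)) :
    ((∫ t, ‖∑ i ∈ s, c i * g i t‖ ^ 2 : ℝ) : ℂ) =
      ∑ j ∈ s, conj (c j) * ∑ i ∈ s, c i * weilConv (g i) (weilReflect (g j)) 0 := by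
  rw [← weilConv_weilReflect_apply_zero (fun t => ∑ i ∈ s, c i * g i t),
    stub_branchesContinuous_weilConv_weilReflect_comb s c hg]

/-- Continuity of `c ↦ Re Q(∑ cᵢ gᵢ)` on the coefficient space (a polynomial in `c, conj c`).
[folklore] -/
theorem stub_branchesContinuous_continuous_re_weilQuadratic :
    ∀ {k : ℕ} {g : Fin (k + 1) → ℝ → ℂ}, (∀ i, IsWeilTest (g i)) →
      Continuous fun c : Fin (k + 1) → ℂ =>
        (weilQuadratic (fun t => ∑ i, c i * g i t)).re := by
  intro k g hg
  have e : (fun c : Fin (k + 1) → ℂ => (weilQuadratic (fun t => ∑ i, c i * g i t)).re) =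
      fun c => (∑ j, conj (c j) * ∑ i, c i *
        weilFunctional (weilConv (g i) (weilReflect (g j)))).re := by
    funext c
    rw [stub_branchesContinuous_weilQuadratic_comb Finset.univ c fun i _ => hg i]
  rw [e]
  refine Complex.continuous_re.comp (continuous_finsetSum _ fun j _ => ?_)
  refine (Complex.continuous_conj.comp (continuous_apply j)).mul
    (continuous_finsetSum _ fun i _ => ?_)
  exact (continuous_apply i).mul continuous_const

/-- Continuity of `c ↦ ∫ ‖∑ cᵢ gᵢ‖²` on the coefficient space. [folklore] -/
theorem stub_branchesContinuous_continuous_integral_norm_sq {k : ℕ} {g : Fin (k + 1) → ℝ → ℂ}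
    (hg : ∀ i, IsWeilTest (g i)) :
    Continuous fun c : Fin (k + 1) → ℂ => ∫ t, ‖∑ i, c i * g i t‖ ^ 2 := by
  have e : (fun c : Fin (k + 1) → ℂ => ∫ t, ‖∑ i, c i * g i t‖ ^ 2) =
      fun c => (∑ j, conj (c j) * ∑ i, c i * weilConv (g i) (weilReflect (g j)) 0).re := by
    funext c
    rw [← stub_branchesContinuous_integral_norm_sq_comb Finset.univ c fun i _ => hg i,
      Complex.ofReal_re]
  rw [e]
  refine Complex.continuous_re.comp (continuous_finsetSum _ fun j _ => ?_)
  refine (Complex.continuous_conj.comp (continuous_apply j)).mul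
    (continuous_finsetSum _ fun i _ => ?_)
  exact (continuous_apply i).mul continuous_const

/-! ## Dilation of combinations -/

/-- Bombieri's dilation is linear: `(∑ cᵢ gᵢ)_η = ∑ cᵢ (gᵢ)_η`. [folklore] -/
theorem stub_branchesContinuous_weilDilate_comb (η : ℝ) (s : Finset ι) (c : ι → ℂ)
    (g : ι → ℝ → ℂ) :
    weilDilate η (fun t => ∑ i ∈ s, c i * g i t) = fun t => ∑ i ∈ s, c i * weilDilate η (g i) t := by
  funext t
  simp only [weilDilate_apply, Finset.mul_sum]
  exact Finset.sum_congr rfl fun i _ => by ring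

/-- The dilation (`η > -1`) preserves linear independence of a tuple of functions (it is an
injective linear map). [folklore] -/
theorem stub_branchesContinuous_linearIndependent_weilDilate {k : ℕ} {g : Fin (k + 1) → ℝ → ℂ}
    {η : ℝ} (hη : -1 < η) (hli : LinearIndependent ℂ g) :
    LinearIndependent ℂ (fun i => weilDilate η (g i)) := by
  rw [Fintype.linearIndependent_iff] at hli ⊢
  intro c hc
  apply hli c
  have h1η : (1 + η) ≠ 0 := ne_of_gt (by linarith)
  have hne : ((Real.sqrt (1 + η) : ℝ) : ℂ) ≠ 0 :=
    Complex.ofReal_ne_zero.2 (Real.sqrt_pos.2 (by linarith)).ne'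
  funext x
  have hx := congr_fun hc (x / (1 + η))
  simp only [Finset.sum_apply, Pi.smul_apply, smul_eq_mul, Pi.zero_apply, weilDilate_apply]
    at hx ⊢
  have h1 : (1 + η) * (x / (1 + η)) = x := by field_simp
  simp only [h1] at hx
  have h2 : ∑ i, c i * (((Real.sqrt (1 + η) : ℝ) : ℂ) * g i x) =
      ((Real.sqrt (1 + η) : ℝ) : ℂ) * ∑ i, c i * g i x := by
    rw [Finset.mul_sum]
    exact Finset.sum_congr rfl fun i _ => by ring
  rw [h2] at hx
  exact (mul_eq_zero.1 hx).resolve_left hne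

/-- `L²`-homogeneity on combinations: `∫ ‖∑ (r cᵢ) gᵢ‖² = |r|² ∫ ‖∑ cᵢ gᵢ‖²`. [folklore] -/
theorem stub_branchesContinuous_integral_norm_sq_smul (s : Finset ι) (r : ℂ) (c : ι → ℂ)
    (g : ι → ℝ → ℂ) :
    ∫ t, ‖∑ i ∈ s, (r • c) i * g i t‖ ^ 2 = ‖r‖ ^ 2 * ∫ t, ‖∑ i ∈ s, c i * g i t‖ ^ 2 := by
  have e : ∀ t, ∑ i ∈ s, (r • c) i * g i t = r * ∑ i ∈ s, c i * g i t := fun t => by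
    rw [Finset.mul_sum]
    exact Finset.sum_congr rfl fun i _ => by simp [mul_assoc]
  simp_rw [e, norm_mul, mul_pow]
  exact integral_const_mul _ _

end Summit.RiemannHypothesis.RiemannHypothesis.Theorems.RuelleBandCofiniteCriticalLine

end
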